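import Summits.QuantumFields.BalabanUV.Beta.GAN24.WilsonTripleGaugeZero
import Summits.QuantumFields.BalabanUV.Beta.GAN24.TripleWardReadout
import Summits.QuantumFields.BalabanUV.Beta.GAN24.ContactKernelCells

/-!
# `BalabanUV.Beta.GAN24.WilsonMixedGaugeCurvature` — binder row G-an2-4 ∕ (CONV-C), W-slot CT-W, the (α) exit's WARD-IDENTITY PARTS (summit-lead RULING R-lead-g77-1 (2),
# journal `CLAIMS.log` l.48491; the OWNER gan24-p1 g32's located consequence «(LT)'s failure, if in the Wilson channel at all, lives in the MIXED modes», leaf-03 g64 W-4 l.48447):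
# **THE MIXED CELLS OF THE BORN WILSON LETTER READ THE THIRD LEG ONLY THROUGH ITS CURVATURE — with the slot leg and the row leg pure gauges (`dz g`, `dz f`) and the
# column leg `r` ARBITRARY, `push₃ (dz f) r (dz g) (wilsonA d) = −½·⟨curv r, curv (g·dz f)⟩`** (the companion of `WilsonTripleGaugeZero`: two longitudinal legs ⟹ the
# curvature of the third) (G-an2-4 formalisation swarm → CRUX TEAM (2), leaf prover `b2b-balaban-gan24-formalise-leaf-01`, gen 70; INTENT I-leaf01-g70-2, l.48748)

NOT IN PRINT; OUR BOOKKEEPING ([folklore]: MY `WilsonTripleGaugeZero` core (§2 ∕ §2b slot reads, the left-leg Maxwell contraction) + the lead's Green identity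
`KKTFluctuationEnergy.lip1_curvAdj` + leaf-02 g46's laws underneath; leaf-03 g64's `exists_legDecay_legChain`, MY g58 `ContactKernelCells.legAct_delta1_eq`, an2∕leaf-03 g41's `curv_legAct_legChain_respStepBm` for §5; 0 `def`, 0 cited fact, 0 `def … : Prop`, 0 sorry).  HONEST FRAMING (cell contract, verbatim):
«discharging `BetaPertH` makes Bałaban's UV stability UNCONDITIONAL — a real constructive-QFT result; it is NOT the continuum limit and NOT the Clay problem.»  HONEST
DEPENDENCY (verbatim): «continuum YM on T⁴ ⇐ BetaPertH ∧ nine spine estimates (0/9 proved); BetaPertH ⇐ (D1) ∧ (D4) ∧ CAP+tail; G-an2-4 gates asym, D1 and NE2/3/4.»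

## Why
`WilsonTripleGaugeZero` nulls the gauge⊗gauge⊗gauge cell of the born Wilson table (three longitudinal legs).  The next cells of the block-constant-gauge-mode
bookkeeping are the MIXED ones: two legs longitudinal, one generic.  For the (slot, row) pair this file gives the cell in closed form with NO hypothesis on the
third (column) leg: the inner contraction of the core is `−½·(d*d (g·dz f))`, so the cell is `−½·Σ' r·d*d(g·dz f)`, and by Green `−½·⟨curv r, curv (g·dz f)⟩`:
THE GENERIC LEG IS READ ONLY THROUGH ITS LATTICE CURVATURE.  Located consequence (TYPED in §5 for the column leg): for the literal's dressed
chain legs `T`, `RespStepBmDecompPsi.curv_legAct_legChain_respStepBm` says the dressed leg's curvature is the UNDRESSED composite's (`curv ∘ dz = 0` kills both the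
accumulated gauge `Ψ` and the block-axial dressing `Π`); so the Wilson channel's (slot-gauge, row-gauge, T) cells of the transported letter are `Ψ`-BLIND at every
depth — after the null triple cell, a `Ψ`-tower in the Wilson channel can only be sourced through the SINGLE-gauge cells (leaf-02 g46's `ContactOneGaugeCell.cell_eq`,
which read `d*dT = 𝒬ᵀΦ` multiplier words) or it is not in the Wilson channel at all (the non-Wilson components of the defect letter `σ_m`; the OWNER's E41 ∕ R28).

## What (generic `d`; `W := wilsonA d`; `d*d := curvAdj ∘ curv`; `m_{G,f} := fun κ v ↦ G v · dz f κ v`)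
* §1 **`tsum_sum_mul_vertexW_eq_of_contact`** — THE INNER CONTRACTION, hypothesis-free: if the slot read of `S` at `(κ₀,U)` is the Maxwell contact with gauge function `G`
  and the left slice is `l α₀ y = dz f`, then `Σ'_x Σ_{κ₁} l α₀ y κ₁ x · vertexW w S κ₀ U x z₁ (inl κ₁) (inl κ₂) = −½·(d*d m_{G,f})_{κ₂}(z₁)` (the core's first half, exposed).
* §2 **`push₃_inl_inl_eq_tsum_of_contact`** (hypothesis-free beyond the two slices): `push₃ l r w S κ₀ U y z (inl α₀) (inl β₀) = −½·Σ'_{z₁} Σ_{κ₂} r β₀ z κ₂ z₁·(d*d m_{G,f})_{κ₂}(z₁)`;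
  **`push₃_inl_inl_eq_lip2_curv_of_contact`** (`r β₀ z` bounded, `G` bounded, `dz f` summable): `= −½·lip2 (curv (r β₀ z)) (curv m_{G,f})` (Green).
* §3 THE BORN WILSON LETTER: **`push₃_wilsonA_inl_inl_eq_lip2_curv`** (`w κ₀ U = dz g`, `l α₀ y = dz f`; `G = g`), and the block-indicator instance
  **`push₃_gaugeWt_col_wilsonA_eq_lip2_curv`** (`l = Γ_L`, `w = Γ_{L″}`, `L ≥ 1`, ANY bounded column slice): `push₃ Γ_L r Γ_{L″} W κ₀ U y z (inl α₀) (inl β₀)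
  = −½·lip2 (curv (r β₀ z)) (curv (blockInd L″ U · dz (blockInd L y)))` — with `r := Γ_{L′}` the right side is `0` (`curv ∘ dz = 0`), recovering the triple null cell.
* §4 THE MIRROR CELL (slot gauge + COLUMN gauge, ROW leg generic; sign `+`): `summable_curvAdj`, **`tsum_sum_mul_vertexW_eq_of_contact'`** (the inner contraction for a
  GENERIC left slice: `½·G(z₁)·(d*d lₛ) − ½·d*d(G·lₛ)`), **`push₃_inl_inl_eq_lip2_curv_of_contact_right`** (`= ½·lip2 (curv lₛ) (curv (G·dz h))` — no Fubini: both halves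
  are Maxwell contractions, the second dies against `dz h`), **`push₃_wilsonA_inl_inl_eq_lip2_curv_right`**.
* §5 **`push₃_gaugeWt_chain_wilsonA_eq_lip2_curv_undressed`** — THE LITERAL's INSTANCE: with the dressed chain `T = legChain (respStepBmSeq ρ Lc) m k` on the column
  leg, the cell is `−½·lip2 (curv (legAct (respStep (Lc^m) (Lc^(m+k+1))) (delta1 β₀ z))) (curv (blockInd L″ U·dz (blockInd L y)))` — the UNDRESSED composite's curvature
  (`curv_legAct_legChain_respStepBm`; `legAct_delta1_eq`, leaf-03's `exists_legDecay_legChain` for the slice bound): the Wilson channel's mixed cell is `Ψ`-blind and `Π`-blind.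
The (row gauge + column gauge, slot generic) cell is leaf-02 g46's `ContactOneGaugeCell.cell_eq` with `T₃ := dz h` (the slot leg through its Maxwell image) — not
re-typed here.  DECIDES NOTHING about the literal's
(Q-R) ∕ `hLT`; NOTHING of (LT) ∕ (DIV) ∕ (DL) ∕ K-LL-4′ ∕ «T2Shape» discharged or refuted; 0 wall binders; NEVER «G-an2-4 closed» as (CONV-C); NOT D1, NOT `BetaPertH`,
NOT continuum, NOT Clay; not in print — our bookkeeping.  2026-08-23; no existing file touched.
-/

noncomputable section

open Finset
open scoped BigOperators
open Literature.MathematicalPhysics.QuantumFieldTheory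
open Literature.MathematicalPhysics.QuantumFieldTheory.Balaban1983to89
open Literature.MathematicalPhysics.QuantumFieldTheory.Balaban1983to89.Beta
open ExpKernelCalculus (MKer)
open StepJetData (wilsonA)
open AffineAveraging (Form0 Form1 Form2 dz curv curvAdj curv_dz)
open AveragingContours (blk)
open KKTFluctuationKernel (delta1)
open KKTFluctuationEnergy (lip1 lip2 lip1_curvAdj summable_curv abs_dz_le summable_mul_of_bdd summable_dz)
open Summit.QuantumFields.BalabanUV.Beta.GAN24.WilsonTripleGaugeZero (tsum_sum_dz_mul_curvAdj_curv_eq_zero)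
open OneStepResolventKernel (Fib)
open Summit.QuantumFields.BalabanUV.Beta.KernelWardRelative (gaugeWt)
open Summit.QuantumFields.BalabanUV.Beta.KernelWardHColumnFixed (blockInd abs_blockInd_le summable_blockInd)
open Summit.QuantumFields.BalabanUV.Beta.GAN24.Push4 (vertexW vertexW_apply)
open Summit.QuantumFields.BalabanUV.Beta.GAN24.Push3 (push₃ push₃_inl_inl)
open Summit.QuantumFields.BalabanUV.Beta.GAN24.ContactOneGaugeCellMaxwell (tsum_mul_curvAdj_curv_delta1 summable_mul_curvAdj_curv_delta1)
open Summit.QuantumFields.BalabanUV.Beta.GAN24.WardPairingCoarse (curvAdj_curv_dz)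
open Summit.QuantumFields.BalabanUV.Beta.GAN24.WilsonTripleGaugeZero (vertexW_wilsonA_inl_inl_of_exact gaugeWt_eq_dz_blockInd)
open Summit.QuantumFields.BalabanUV.Beta.GAN24.Push4Iter (legChain)
open Summit.QuantumFields.BalabanUV.Beta.GAN24.Push4Bounds (LegDecay)
open Summit.QuantumFields.BalabanUV.Beta.GAN24.RespStepBmDecompLegs (legAct)
open Summit.QuantumFields.BalabanUV.Beta.GAN24.RespStepBmDecompExact (respStepBmSeq)
open Summit.QuantumFields.BalabanUV.Beta.GAN24.RespStepBmDecompPsi (curv_legAct_legChain_respStepBm)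
open Summit.QuantumFields.BalabanUV.Beta.GAN24.ContactKernelCells (legAct_delta1_eq summable_delta1)
open Summit.QuantumFields.BalabanUV.Beta.GAN24.TripleWardReadout (exists_legDecay_legChain)
open BalabanCompositeJets (respStep)
open AffineAveraging (box toSite)

namespace Summit.QuantumFields.BalabanUV.Beta.GAN24.WilsonMixedGaugeCurvature

variable {d : ℕ}

section Contact

variable {l r w : Fin (d + 1) → (Fin (d + 1) → ℤ) → Fin (d + 1) → (Fin (d + 1) → ℤ) → ℝ}
  {S : Fin (d + 1) → (Fin (d + 1) → ℤ) → MKer (d + 1) (Fib d)}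
  {α₀ β₀ κ₀ : Fin (d + 1)} {y z U : Fin (d + 1) → ℤ} {f G : Form0 (d + 1) ℝ} {MG Mr : ℝ}

/-! ## §1 The inner contraction in closed form -/

/-- [folklore] **THE INNER CONTRACTION** (hypothesis-free beyond the slot contact and the exact left slice): if
`vertexW w S κ₀ U x z (inl a) (inl b) = ½(G z − G x)·(d*dδ_{(b,z)})_a(x)` and `l α₀ y = dz f`, then for every fine column index `(κ₂, z₁)`
`Σ'_x Σ_{κ₁} l α₀ y κ₁ x · vertexW w S κ₀ U x z₁ (inl κ₁) (inl κ₂) = −½·(d*d (G·dz f))_{κ₂}(z₁)` — the Maxwell contraction twice (`tsum_mul_curvAdj_curv_delta1`, windows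
finite, no summability needed) and `d*d (dz f) = 0`. -/
theorem tsum_sum_mul_vertexW_eq_of_contact
    (hV : ∀ (x z : Fin (d + 1) → ℤ) (a b : Fin (d + 1)),
      vertexW w S κ₀ U x z (Sum.inl a) (Sum.inl b) = (1 / 2 : ℝ) * (G z - G x) * curvAdj (curv (delta1 b z)) a x)
    (hl : l α₀ y = dz f) (z₁ : Fin (d + 1) → ℤ) (κ₂ : Fin (d + 1)) :
    ∑' x, ∑ κ₁, l α₀ y κ₁ x * vertexW w S κ₀ U x z₁ (Sum.inl κ₁) (Sum.inl κ₂)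
      = -(1 / 2 : ℝ) * curvAdj (curv (fun κ v => G v * dz f κ v)) κ₂ z₁ := by
  have e : ∀ x, ∑ κ₁, l α₀ y κ₁ x * vertexW w S κ₀ U x z₁ (Sum.inl κ₁) (Sum.inl κ₂) =
      (1 / 2 : ℝ) * G z₁ * (∑ κ₁, dz f κ₁ x * curvAdj (curv (delta1 κ₂ z₁)) κ₁ x) -
        (1 / 2 : ℝ) * (∑ κ₁, (fun κ v => G v * dz f κ v) κ₁ x * curvAdj (curv (delta1 κ₂ z₁)) κ₁ x) := by
    intro x
    rw [Finset.mul_sum, Finset.mul_sum, ← Finset.sum_sub_distrib]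
    refine Finset.sum_congr rfl fun κ₁ _ => ?_
    rw [hV x z₁ κ₁ κ₂, hl]
    ring
  rw [tsum_congr e, ((summable_mul_curvAdj_curv_delta1 (dz f) κ₂ z₁).mul_left _).tsum_sub
    ((summable_mul_curvAdj_curv_delta1 (fun κ v => G v * dz f κ v) κ₂ z₁).mul_left _), tsum_mul_left, tsum_mul_left,
    tsum_mul_curvAdj_curv_delta1 (dz f) κ₂ z₁, tsum_mul_curvAdj_curv_delta1 (fun κ v => G v * dz f κ v) κ₂ z₁, curvAdj_curv_dz]
  simp only [Pi.zero_apply, mul_zero, zero_sub]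
  ring

/-! ## §2 The mixed cell: the column leg through its Maxwell image ∕ its curvature -/

/-- NOT IN PRINT; OUR BOOKKEEPING.  **THE (slot-gauge, row-gauge, GENERIC column) CELL, HYPOTHESIS-FREE**: under the slot contact with gauge function `G` and the
exact left slice `l α₀ y = dz f`, for ANY right leg `r`,
`push₃ l r w S κ₀ U y z (inl α₀) (inl β₀) = −½·Σ'_{z₁} Σ_{κ₂} r β₀ z κ₂ z₁ · (d*d (G·dz f))_{κ₂}(z₁)` — the column leg is read against the Maxwell image of the
weighted left gauge (`Push3.push₃_inl_inl` ⨾ §1 ⨾ `tsum_mul_left`; no convergence hypothesis: both sides are the same series). -/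
theorem push₃_inl_inl_eq_tsum_of_contact
    (hV : ∀ (x z : Fin (d + 1) → ℤ) (a b : Fin (d + 1)),
      vertexW w S κ₀ U x z (Sum.inl a) (Sum.inl b) = (1 / 2 : ℝ) * (G z - G x) * curvAdj (curv (delta1 b z)) a x)
    (hl : l α₀ y = dz f) :
    push₃ l r w S κ₀ U y z (Sum.inl α₀) (Sum.inl β₀)
      = -(1 / 2 : ℝ) * ∑' z₁, ∑ κ₂, r β₀ z κ₂ z₁ * curvAdj (curv (fun κ v => G v * dz f κ v)) κ₂ z₁ := by
  rw [push₃_inl_inl]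
  have e2 : ∀ z₁, ∑ κ₂, (∑' x, ∑ κ₁, l α₀ y κ₁ x * vertexW w S κ₀ U x z₁ (Sum.inl κ₁) (Sum.inl κ₂)) * r β₀ z κ₂ z₁ =
      -(1 / 2 : ℝ) * ∑ κ₂, r β₀ z κ₂ z₁ * curvAdj (curv (fun κ v => G v * dz f κ v)) κ₂ z₁ := by
    intro z₁
    rw [Finset.mul_sum]
    refine Finset.sum_congr rfl fun κ₂ _ => ?_
    rw [tsum_sum_mul_vertexW_eq_of_contact hV hl z₁ κ₂]
    ring
  rw [tsum_congr e2, tsum_mul_left]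

/-- NOT IN PRINT; OUR BOOKKEEPING.  **THE MIXED CELL READS THE GENERIC LEG ONLY THROUGH ITS CURVATURE**: if moreover the column slice `r β₀ z` is BOUNDED, `G` is bounded
and `dz f` is summable, then `push₃ l r w S κ₀ U y z (inl α₀) (inl β₀) = −½·lip2 (curv (r β₀ z)) (curv (G·dz f))` — Green's identity `⟨A, d*d m⟩ = ⟨curv A, curv m⟩`
(`KKTFluctuationEnergy.lip1_curvAdj`).  With `r β₀ z` itself a pure gauge the right side is `0` (`curv ∘ dz = 0`): `WilsonTripleGaugeZero`'s null cell is the special case. -/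
theorem push₃_inl_inl_eq_lip2_curv_of_contact
    (hV : ∀ (x z : Fin (d + 1) → ℤ) (a b : Fin (d + 1)),
      vertexW w S κ₀ U x z (Sum.inl a) (Sum.inl b) = (1 / 2 : ℝ) * (G z - G x) * curvAdj (curv (delta1 b z)) a x)
    (hl : l α₀ y = dz f) (hr : ∀ κ v, |r β₀ z κ v| ≤ Mr) (hG : ∀ v, |G v| ≤ MG) (hf : ∀ κ, Summable (dz f κ)) :
    push₃ l r w S κ₀ U y z (Sum.inl α₀) (Sum.inl β₀) = -(1 / 2 : ℝ) * lip2 (curv (r β₀ z)) (curv (fun κ v => G v * dz f κ v)) := by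
  have hms : ∀ κ, Summable ((fun κ v => G v * dz f κ v) κ) := fun κ => summable_mul_of_bdd hG (hf κ)
  rw [push₃_inl_inl_eq_tsum_of_contact hV hl, ← lip1_curvAdj hr (fun κ l => summable_curv hms κ l)]
  rfl

end Contact

/-! ## §3 The born Wilson letter and the block-indicator gauge legs -/

section Wilson

variable {l r w : Fin (d + 1) → (Fin (d + 1) → ℤ) → Fin (d + 1) → (Fin (d + 1) → ℤ) → ℝ}
  {α₀ β₀ κ₀ : Fin (d + 1)} {y z U : Fin (d + 1) → ℤ} {f g : Form0 (d + 1) ℝ} {Mg Mr : ℝ}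

/-- NOT IN PRINT; OUR BOOKKEEPING.  **THE BORN WILSON LETTER's MIXED CELL**: slot slice `w κ₀ U = dz g` (`g` bounded), row slice `l α₀ y = dz f` (`dz f` summable), column
leg `r` with bounded slice ⟹ `push₃ l r w (wilsonA d) κ₀ U y z (inl α₀) (inl β₀) = −½·lip2 (curv (r β₀ z)) (curv (g·dz f))`. -/
theorem push₃_wilsonA_inl_inl_eq_lip2_curv (hw : w κ₀ U = dz g) (hl : l α₀ y = dz f)
    (hr : ∀ κ v, |r β₀ z κ v| ≤ Mr) (hg : ∀ v, |g v| ≤ Mg) (hf : ∀ κ, Summable (dz f κ)) :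
    push₃ l r w (wilsonA d) κ₀ U y z (Sum.inl α₀) (Sum.inl β₀) = -(1 / 2 : ℝ) * lip2 (curv (r β₀ z)) (curv (fun κ v => g v * dz f κ v)) :=
  push₃_inl_inl_eq_lip2_curv_of_contact (fun x z a b => vertexW_wilsonA_inl_inl_of_exact w κ₀ U g hw x z a b) hl hr hg hf

/-- NOT IN PRINT; OUR BOOKKEEPING.  **THE SAME, HYPOTHESIS-FREE IN SERIES FORM** (any column leg; `g`, `f` arbitrary):
`push₃ l r w (wilsonA d) κ₀ U y z (inl α₀) (inl β₀) = −½·Σ'_{z₁} Σ_{κ₂} r β₀ z κ₂ z₁ · (d*d (g·dz f))_{κ₂}(z₁)`. -/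
theorem push₃_wilsonA_inl_inl_eq_tsum (hw : w κ₀ U = dz g) (hl : l α₀ y = dz f) :
    push₃ l r w (wilsonA d) κ₀ U y z (Sum.inl α₀) (Sum.inl β₀)
      = -(1 / 2 : ℝ) * ∑' z₁, ∑ κ₂, r β₀ z κ₂ z₁ * curvAdj (curv (fun κ v => g v * dz f κ v)) κ₂ z₁ :=
  push₃_inl_inl_eq_tsum_of_contact (fun x z a b => vertexW_wilsonA_inl_inl_of_exact w κ₀ U g hw x z a b) hl

end Wilson

/-- NOT IN PRINT; OUR BOOKKEEPING.  **THE BLOCK-INDICATOR GAUGE LEGS WITH A GENERIC COLUMN LEG** — the (slot, row)-mixed companion of leaf-03's triple face charge at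
`S := wilsonA d`: for blockings `L ≥ 1` (row) and `L″` (slot), any column leg `r` with bounded slice at `(β₀, z)`,
`push₃ Γ_L r Γ_{L″} (wilsonA d) κ₀ U y z (inl α₀) (inl β₀) = −½·lip2 (curv (r β₀ z)) (curv (blockInd L″ U · dz (blockInd L y)))`
— the column leg enters ONLY THROUGH ITS CURVATURE (for the dressed chain legs: the undressed composite's, `RespStepBmDecompPsi.curv_legAct_legChain_respStepBm`). -/
theorem push₃_gaugeWt_col_wilsonA_eq_lip2_curv {L : ℕ} (hL : 1 ≤ L) (L'' : ℕ)
    (r : Fin (d + 1) → (Fin (d + 1) → ℤ) → Fin (d + 1) → (Fin (d + 1) → ℤ) → ℝ) {Mr : ℝ}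
    (κ₀ α₀ β₀ : Fin (d + 1)) (U y z : Fin (d + 1) → ℤ) (hr : ∀ κ v, |r β₀ z κ v| ≤ Mr) :
    push₃ (fun (_ : Fin (d + 1)) => gaugeWt (d := d) L) r (fun (_ : Fin (d + 1)) => gaugeWt (d := d) L'') (wilsonA d) κ₀ U y z (Sum.inl α₀) (Sum.inl β₀)
      = -(1 / 2 : ℝ) * lip2 (curv (r β₀ z)) (curv (fun κ v => blockInd L'' U v * dz (blockInd L y) κ v)) :=
  push₃_wilsonA_inl_inl_eq_lip2_curv (κ₀ := κ₀) (U := U) (α₀ := α₀) (y := y) (gaugeWt_eq_dz_blockInd L'' U) (gaugeWt_eq_dz_blockInd L y)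
    hr (abs_blockInd_le L'' U) (fun κ => summable_dz (summable_blockInd hL y) κ)

/-! ## §4 The mirror cell: slot gauge + COLUMN gauge, the ROW leg generic -/

section Mirror

variable {l r w : Fin (d + 1) → (Fin (d + 1) → ℤ) → Fin (d + 1) → (Fin (d + 1) → ℤ) → ℝ}
  {S : Fin (d + 1) → (Fin (d + 1) → ℤ) → MKer (d + 1) (Fib d)}
  {α₀ β₀ κ₀ : Fin (d + 1)} {y z U : Fin (d + 1) → ℤ} {h G g : Form0 (d + 1) ℝ} {MG Mh Mg : ℝ}

/-- [folklore] `curvAdj` of a summable 2-form is summable (finite sums of shifts). -/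
theorem summable_curvAdj {F : Form2 (d + 1) ℝ} (hF : ∀ κ l, Summable (F κ l)) (μ : Fin (d + 1)) : Summable (curvAdj F μ) := by
  have h : Summable fun y => (∑ l, (F μ l y - F μ l (y - AffineAveraging.unitVec l)))
      + ∑ κ, (F κ μ (y - AffineAveraging.unitVec κ) - F κ μ y) :=
    (summable_sum fun l _ => (hF μ l).sub (KKTFluctuationEnergy.summable_shift_sub (hF μ l) _)).add
      (summable_sum fun κ _ => (KKTFluctuationEnergy.summable_shift_sub (hF κ μ) _).sub (hF κ μ))
  exact h.congr fun y => by simp only [AffineAveraging.curvAdj]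

/-- [folklore] **THE INNER CONTRACTION FOR A GENERIC LEFT LEG** (hypothesis-free beyond the slot contact): for ANY left slice `lₛ := l α₀ y`,
`Σ'_x Σ_{κ₁} lₛ κ₁ x · vertexW w S κ₀ U x z₁ (inl κ₁) (inl κ₂) = ½·G(z₁)·(d*d lₛ)_{κ₂}(z₁) − ½·(d*d (G·lₛ))_{κ₂}(z₁)` (two Maxwell contractions; §1 is the case `lₛ = dz f`). -/
theorem tsum_sum_mul_vertexW_eq_of_contact'
    (hV : ∀ (x z : Fin (d + 1) → ℤ) (a b : Fin (d + 1)),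
      vertexW w S κ₀ U x z (Sum.inl a) (Sum.inl b) = (1 / 2 : ℝ) * (G z - G x) * curvAdj (curv (delta1 b z)) a x)
    (z₁ : Fin (d + 1) → ℤ) (κ₂ : Fin (d + 1)) :
    ∑' x, ∑ κ₁, l α₀ y κ₁ x * vertexW w S κ₀ U x z₁ (Sum.inl κ₁) (Sum.inl κ₂)
      = (1 / 2 : ℝ) * G z₁ * curvAdj (curv (l α₀ y)) κ₂ z₁ - (1 / 2 : ℝ) * curvAdj (curv (fun κ v => G v * l α₀ y κ v)) κ₂ z₁ := by
  have e : ∀ x, ∑ κ₁, l α₀ y κ₁ x * vertexW w S κ₀ U x z₁ (Sum.inl κ₁) (Sum.inl κ₂) =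
      (1 / 2 : ℝ) * G z₁ * (∑ κ₁, l α₀ y κ₁ x * curvAdj (curv (delta1 κ₂ z₁)) κ₁ x) -
        (1 / 2 : ℝ) * (∑ κ₁, (fun κ v => G v * l α₀ y κ v) κ₁ x * curvAdj (curv (delta1 κ₂ z₁)) κ₁ x) := by
    intro x
    rw [Finset.mul_sum, Finset.mul_sum, ← Finset.sum_sub_distrib]
    refine Finset.sum_congr rfl fun κ₁ _ => ?_
    rw [hV x z₁ κ₁ κ₂]
    ring
  rw [tsum_congr e, ((summable_mul_curvAdj_curv_delta1 (l α₀ y) κ₂ z₁).mul_left _).tsum_sub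
    ((summable_mul_curvAdj_curv_delta1 (fun κ v => G v * l α₀ y κ v) κ₂ z₁).mul_left _), tsum_mul_left, tsum_mul_left,
    tsum_mul_curvAdj_curv_delta1 (l α₀ y) κ₂ z₁, tsum_mul_curvAdj_curv_delta1 (fun κ v => G v * l α₀ y κ v) κ₂ z₁]

/-- NOT IN PRINT; OUR BOOKKEEPING.  **THE (slot-gauge, GENERIC row, column-gauge) CELL READS THE ROW LEG ONLY THROUGH ITS CURVATURE** (sign `+`, the mirror of §2):
under the slot contact with bounded `G`, a SUMMABLE row slice `l α₀ y`, and an exact column slice `r β₀ z = dz h` with `h` bounded,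
`push₃ l r w S κ₀ U y z (inl α₀) (inl β₀) = ½·lip2 (curv (l α₀ y)) (curv (G·dz h))` — the `d*d(G·lₛ)` half pairs against `dz h` and vanishes
(`WilsonTripleGaugeZero.tsum_sum_dz_mul_curvAdj_curv_eq_zero`), the `G·d*d lₛ` half is Green's `⟨G·dz h, d*d lₛ⟩ = ⟨curv (G·dz h), curv lₛ⟩`.  NO Fubini is needed:
both halves are Maxwell contractions. -/
theorem push₃_inl_inl_eq_lip2_curv_of_contact_right
    (hV : ∀ (x z : Fin (d + 1) → ℤ) (a b : Fin (d + 1)),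
      vertexW w S κ₀ U x z (Sum.inl a) (Sum.inl b) = (1 / 2 : ℝ) * (G z - G x) * curvAdj (curv (delta1 b z)) a x)
    (hls : ∀ κ, Summable (l α₀ y κ)) (hr : r β₀ z = dz h) (hh : ∀ v, |h v| ≤ Mh) (hG : ∀ v, |G v| ≤ MG) :
    push₃ l r w S κ₀ U y z (Sum.inl α₀) (Sum.inl β₀) = (1 / 2 : ℝ) * lip2 (curv (l α₀ y)) (curv (fun κ v => G v * dz h κ v)) := by
  have hMG : 0 ≤ MG := (abs_nonneg _).trans (hG 0)
  -- summability of the two Maxwell images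
  have hs1 : ∀ μ, Summable (curvAdj (curv (l α₀ y)) μ) := fun μ => summable_curvAdj (fun κ l' => summable_curv hls κ l') μ
  have hGl : ∀ κ, Summable ((fun κ v => G v * l α₀ y κ v) κ) := fun κ => summable_mul_of_bdd hG (hls κ)
  -- the bounded gauge 1-form `G·dz h`
  have hA : ∀ μ x, |(fun μ x => G x * dz h μ x) μ x| ≤ MG * (2 * Mh) := fun μ x => by
    simp only
    rw [abs_mul]
    exact mul_le_mul (hG x) (abs_dz_le hh μ x) (abs_nonneg _) hMG
  rw [push₃_inl_inl]
  have e2 : ∀ z₁, ∑ κ₂, (∑' x, ∑ κ₁, l α₀ y κ₁ x * vertexW w S κ₀ U x z₁ (Sum.inl κ₁) (Sum.inl κ₂)) * r β₀ z κ₂ z₁ =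
      (1 / 2 : ℝ) * (∑ κ₂, (fun μ x => G x * dz h μ x) κ₂ z₁ * curvAdj (curv (l α₀ y)) κ₂ z₁) -
        (1 / 2 : ℝ) * (∑ κ₂, dz h κ₂ z₁ * curvAdj (curv (fun κ v => G v * l α₀ y κ v)) κ₂ z₁) := by
    intro z₁
    rw [Finset.mul_sum, Finset.mul_sum, ← Finset.sum_sub_distrib]
    refine Finset.sum_congr rfl fun κ₂ _ => ?_
    rw [tsum_sum_mul_vertexW_eq_of_contact' hV z₁ κ₂, hr]
    ring
  -- summability of the two outer parts
  have hp1 : Summable fun z₁ => ∑ κ₂, (fun μ x => G x * dz h μ x) κ₂ z₁ * curvAdj (curv (l α₀ y)) κ₂ z₁ :=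
    summable_sum fun κ₂ _ => summable_mul_of_bdd (hA κ₂) (hs1 κ₂)
  have hp2 : Summable fun z₁ => ∑ κ₂, dz h κ₂ z₁ * curvAdj (curv (fun κ v => G v * l α₀ y κ v)) κ₂ z₁ :=
    summable_sum fun κ₂ _ => summable_mul_of_bdd (abs_dz_le hh κ₂) (summable_curvAdj (fun κ l' => summable_curv hGl κ l') κ₂)
  rw [tsum_congr e2, (hp1.mul_left _).tsum_sub (hp2.mul_left _), tsum_mul_left, tsum_mul_left,
    tsum_sum_dz_mul_curvAdj_curv_eq_zero hh hGl, mul_zero, sub_zero]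
  have hG2 := lip1_curvAdj (A := fun μ x => G x * dz h μ x) (F := curv (l α₀ y)) hA (fun κ l' => summable_curv hls κ l')
  unfold lip1 at hG2
  rw [hG2, KKTFluctuationEnergy.lip2_comm]

/-- NOT IN PRINT; OUR BOOKKEEPING.  **THE BORN WILSON LETTER's MIRROR CELL**: slot slice `w κ₀ U = dz g` (`g` bounded), row leg with SUMMABLE slice, column slice
`r β₀ z = dz h` (`h` bounded) ⟹ `push₃ l r w (wilsonA d) κ₀ U y z (inl α₀) (inl β₀) = ½·lip2 (curv (l α₀ y)) (curv (g·dz h))`. -/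
theorem push₃_wilsonA_inl_inl_eq_lip2_curv_right (hw : w κ₀ U = dz g) (hls : ∀ κ, Summable (l α₀ y κ))
    (hr : r β₀ z = dz h) (hh : ∀ v, |h v| ≤ Mh) (hg : ∀ v, |g v| ≤ Mg) :
    push₃ l r w (wilsonA d) κ₀ U y z (Sum.inl α₀) (Sum.inl β₀) = (1 / 2 : ℝ) * lip2 (curv (l α₀ y)) (curv (fun κ v => g v * dz h κ v)) :=
  push₃_inl_inl_eq_lip2_curv_of_contact_right (fun x z a b => vertexW_wilsonA_inl_inl_of_exact w κ₀ U g hw x z a b) hls hr hh hg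

end Mirror

/-! ## §5 The literal's dressed chain on the generic leg: the Wilson channel's mixed cell reads the UNDRESSED composite's curvature -/

section Literal

variable {Lc : ℕ} [NeZero Lc] {rr : Fin (d + 1) → ℕ}

/-- NOT IN PRINT; OUR BOOKKEEPING.  **THE WILSON CHANNEL's MIXED CELL IS `Ψ`-BLIND AND `Π`-BLIND**: for an in-block root, every base level `m` and depth `k`, with the
literal's dressed chain `T = legChain (respStepBmSeq (toSite rr) Lc) m k` on the COLUMN leg and block-indicator gauges on the slot and row legs (`L ≥ 1`, `L″` any),
`push₃ Γ_L T Γ_{L″} (wilsonA d) κ₀ U y z (inl α₀) (inl β₀) = −½·lip2 (curv (legAct (respStep (Lc^m) (Lc^(m+k+1))) (delta1 β₀ z))) (curv (blockInd L″ U · dz (blockInd L y)))`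
— the dressed leg enters only through its curvature, which is an2's UNDRESSED composite response's (`RespStepBmDecompPsi.curv_legAct_legChain_respStepBm`: `curv ∘ dz = 0`
kills the accumulated gauge `Ψ` AND the block-axial dressing `Π`); the column slice is bounded by leaf-03's `exists_legDecay_legChain`. -/
theorem push₃_gaugeWt_chain_wilsonA_eq_lip2_curv_undressed (hrr : rr ∈ box (d + 1) Lc) (m k : ℕ) {L : ℕ} (hL : 1 ≤ L) (L'' : ℕ)
    (κ₀ α₀ β₀ : Fin (d + 1)) (U y z : Fin (d + 1) → ℤ) :
    push₃ (fun (_ : Fin (d + 1)) => gaugeWt (d := d) L) (legChain (respStepBmSeq (toSite rr) Lc) m k) (fun (_ : Fin (d + 1)) => gaugeWt (d := d) L'')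
        (wilsonA d) κ₀ U y z (Sum.inl α₀) (Sum.inl β₀)
      = -(1 / 2 : ℝ) * lip2 (curv (legAct (respStep (d := d) (Lc ^ m) (Lc ^ (m + k + 1))) (delta1 β₀ z)))
          (curv (fun κ v => blockInd L'' U v * dz (blockInd L y) κ v)) := by
  obtain ⟨C, mr, hmr, hT⟩ := exists_legDecay_legChain hrr m k
  rw [push₃_gaugeWt_col_wilsonA_eq_lip2_curv hL L'' _ κ₀ α₀ β₀ U y z (fun κ v => hT.abs_le hmr.le β₀ z κ v),
    ← legAct_delta1_eq (legChain (respStepBmSeq (toSite rr) Lc) m k) β₀ z,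
    curv_legAct_legChain_respStepBm hrr m k (summable_delta1 β₀ z)]

end Literal

end Summit.QuantumFields.BalabanUV.Beta.GAN24.WilsonMixedGaugeCurvature

end
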